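import Summits.BirchSwinnertonDyer.BirchSwinnertonDyer.Theses.ErratumRoadFive
import Summits.BirchSwinnertonDyer.BirchSwinnertonDyer.Theorems.ErratumRoadFiveControlFromJSWMult
import Summits.BirchSwinnertonDyer.Rank1Residual.X11b.BDPRouteOpenInputTight
import HarnessLib

/-!
# Route `ErratumRoadFive` (rung K2, `p ≥ 5`): route p2's open input AT ONE CLASSICAL FIELD from the published control identity
# and ONE attestable inequality «`ord_p [E(K):ℤP] ≤ ord_p ∏_ℓ c_ℓ(E)`» — the generic form of the per-field certificate rungs (TOOL)

Cell `bsd-stepL` (run/shared/lean/pub/bsd-stepL/), seat `bsd-stepL-imc-p1` (prover g6, 2026-08-26); `--supports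
stmt-BirchSwinnertonDyer-19282 --as helper` (it is the engine of `Theorems/ErratumRoadFiveOpenInputNotRamRung6615d1.lean`, made
pair-free so that the other certificate-rung hands — rest-p2 on 19702 ∕ 19703, imc24b on 19270's split pairs, shim-p1 — can reuse it).

THE OBSERVATION (bookkeeping on PUBLISHED shapes; nothing new is claimed). At a classical Heegner datum `(K, P, κ, γ, 𝔭)` of a pair
`(E, p)`, `p ≥ 5`, the control identity `ControlOnTreeAt` (Cas18 Thm. 2.3 ∕ JSW17 Thm. 3.3.1, `p ∥ N` allowed, any Tamagawa numbers —
in the tree from the named fact `thm331_anticyclotomicControl_mult`, imc-t1 p428223 ∕ p432484) makes the open input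
`IMCLowerWaldspurgerOnTreeAt` EQUIVALENT to STEP L `2·ord_p[E(K):ℤP] ≤ ord_p #Ш(E/K) + 2·ord_p ∏_ℓ c_ℓ(E)`
(`imcLowerWaldspurgerOnTreeAt_iff_indexLowerBoundAt_of_controlOnTreeAt`, multr1-p2). Hence the open input HOLDS at every datum where
  (IDX≤TAM)   `ord_p [E(K):ℤP] ≤ ord_p ∏_ℓ c_ℓ(E)`
— with NO lower bound on `Ш` exercised (`0 ≤ ord_p #Ш`). (IDX≤TAM) is a finite, ATTESTABLE statement about one curve and one field
(the Heegner point is the image of the analytic parametrisation — not kernel-checkable today); by Gross–Zagier ∕ Gross 1991 (2.2) it is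
PREDICTED to hold exactly when `p ∤ #Ш_an(E/K)·(c u_K …)`, i.e. at the `K` where the twist `E^{d_K}` has `p ∤ #Ш_an` (and `p ∤ #Ш_an(E)`).
So: `openInputAtField_of_thm331Mult_of_indexCert` — for ANY globally minimal elliptic `W`, prime `p`, and discriminant `d`: the JSW fact +
Kolyvagin + «(IDX≤TAM) at every datum over a field of discriminant `d` read with `p ∤ c`» ⟹ the body of `P2OpenInputOnTreeAt W p` restricted to
`NumberField.discr K = d`. The per-pair rungs (6615d1 at `d = −59`, …) are this theorem plus a kernel Tamagawa exponent and an attested index.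

HONEST FRAMING: THEOREMS ONLY (no definition, no named fact, no `sorry`); CONDITIONAL on the displayed binders; a slice at one field says nothing
about the other fields of the pair (the genuine content of cruxes 19282 ∕ 19702 ∕ 19703 ∕ 19270 is the ∀-`K` statement, whose twists
`E^{d_K}` with `p ∣ #Ш_an` are exactly where (IDX≤TAM) fails); nothing booked; BSD proved for no pair.

References: [JetchevSkinnerWan2017] Thm. 3.3.1, §3.5 (3.5.c), §7.3.1 (eq:tamK), §7.4.1 (arXiv:1512.06894); [Castella2018] Thm. 2.3, (1.1);
[Kolyvagin1990] Thm. A; [Gross1991] Thm. 1.3, (2.2).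
-/

set_option autoImplicit false
-- the Theorems namespace of this sub repeats the summit name by design (D-0017 nested layout)
set_option linter.dupNamespace false

noncomputable section

open scoped Classical

open WeierstrassCurve IsDedekindDomain NumberField
  Literature.NumberTheory.EllipticCurves Literature.NumberTheory.EllipticCurves.ModularForms
  Literature.NumberTheory.EllipticCurves.Rank1Residual
  Literature.NumberTheory.EllipticCurves.Rank1Residual.Typed
  Literature.NumberTheory.EllipticCurves.JetchevSkinnerWan2017
  Summit.BirchSwinnertonDyer.Rank1Residual Summit.BirchSwinnertonDyer.Rank1Residual.X11b
  Summit.BirchSwinnertonDyer.BirchSwinnertonDyer.Theses.ErratumRoadFive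

namespace Summit.BirchSwinnertonDyer.BirchSwinnertonDyer.Theorems

/-! ## §1 At a datum: (IDX≤TAM) + the control identity ⟹ the open input -/

/-- **(IDX≤TAM) at a classical datum gives STEP L outright** (`0 ≤ ord_p #Ш(E/K)` is all that is used).
[cite: JetchevSkinnerWan2017, §7.4.1 (eq:shalowerK-1) (arXiv:1512.06894 p. 30)] [cite: Castella2018, (1.1) (p. 2)] -/
theorem indexLowerBoundAt_of_index_le_tamagawa (W : WeierstrassCurve ℚ) [W.IsElliptic] [W.IsGloballyMinimal] (p : ℕ) [Fact p.Prime]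
    (K : Type) [Field K] [NumberField K] (P : (W.baseChange K).toAffine.Point)
    (h : padicValNat p (AddSubgroup.zmultiples P).index ≤ padicValNat p W.tamagawaProduct) :
    IndexLowerBoundAt W p K P := by
  unfold IndexLowerBoundAt
  omega

/-- **At a classical Heegner datum with the control identity, (IDX≤TAM) ⟹ (IMC≥∘BDP)ᵗ** (`p ≥ 5`, `K` imaginary quadratic with the
Heegner hypothesis for `N = N_E`, `Ш(E/K)` finite): multr1-p2's `imcLowerWaldspurgerOnTreeAt_of_controlOnTreeAt_of_indexLowerBoundAt` fed
with §1's STEP L. Bookkeeping; nothing asserted about the control identity. [cite: Castella2018, Thm. 2.3 (p. 5), (1.1) (p. 2)]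
[cite: JetchevSkinnerWan2017, §7.3.1 (eq:tamK), §7.4.1 (arXiv:1512.06894 pp. 28, 30)] -/
theorem imcLowerWaldspurgerOnTreeAt_of_controlOnTreeAt_of_index_le_tamagawa
    {W : WeierstrassCurve ℚ} [W.IsElliptic] [W.IsGloballyMinimal] {p : ℕ} [Fact p.Prime] (hp : 5 ≤ p)
    {K : Type} [Field K] [NumberField K] (hK : IsImaginaryQuadratic K) {N : ℕ} (hN : W.conductorNorm ℤ = N)
    (hH : SatisfiesHeegnerHypothesis N K) {P : (W.baseChange K).toAffine.Point} [Finite (W.baseChange K).sha]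
    {κ : ZpExtension K p} {𝔭 : HeightOneSpectrum (𝓞 K)} {γ : Field.absoluteGaloisGroup K} [Fact (κ.IsTopGenerator γ)]
    {ι : K →+* ℚ_[p]} (hCTL : ControlOnTreeAt p κ 𝔭 γ ι P)
    (h : padicValNat p (AddSubgroup.zmultiples P).index ≤ padicValNat p W.tamagawaProduct) :
    IMCLowerWaldspurgerOnTreeAt p κ 𝔭 γ ι P :=
  imcLowerWaldspurgerOnTreeAt_of_controlOnTreeAt_of_indexLowerBoundAt hp hK hN hH hCTL
    (indexLowerBoundAt_of_index_le_tamagawa W p K P h)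

/-! ## §2 At a field: the `d`-slice of `P2OpenInputOnTreeAt W p` from the JSW fact + Kolyvagin + the (IDX≤TAM) certificate at `d` -/

/-- **Route p2's open input of `(W, p)` AT EVERY CLASSICAL DATUM OVER A FIELD OF DISCRIMINANT `d`** — the body of
`P2OpenInputOnTreeAt W p` VERBATIM with the ONE extra binder `NumberField.discr K = d` — from: `h331` = Jetchev–Skinner–Wan 2017 Thm. 3.3.1
at a multiplicative `p` (PUBLISHED named fact; any conductor, any Tamagawa numbers), `hKo` = Kolyvagin (rank one, `#Ш(E/K) < ∞` at a non-torsion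
Heegner point; PUBLISHED), and `hidx` = the (IDX≤TAM) certificate at `d`: at every Heegner point `P` of level `N = N_E` over a field of
discriminant `d`, read through a parametrisation datum with `p ∤ c` (the datum's own Manin binder — a datum with `p ∣ c` rescales the point
by `p`), `ord_p [E(K):ℤP] ≤ ord_p ∏_ℓ c_ℓ(E)` (ATTESTABLE, finite; never a theorem of the tree). Proof: the control identity at the datum
(`p2ControlOnTreeAt_of_thm331Mult`), `Ш(E/K)` finite (`hKo`), §1. CONDITIONAL on the three binders; ONE field per `d`; nothing booked.
[cite: JetchevSkinnerWan2017, Thm. 3.3.1 with §3.5 (3.5.c), §7.4.1 (arXiv:1512.06894 pp. 11, 15, 30)] [cite: Castella2018, Thm. 2.3 (p. 5), (1.1) (p. 2)]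
[cite: Kolyvagin1990, Thm. A] [cite: Gross1991, Thm. 1.3 and (2.2)] -/
theorem openInputAtField_of_thm331Mult_of_indexCert (W : WeierstrassCurve ℚ) [W.IsElliptic] [W.IsGloballyMinimal]
    (p : ℕ) [Fact p.Prime] (d : ℤ)
    (h331 : thm331_anticyclotomicControl_mult)
    (hKo : ∀ (N : ℕ) [NeZero N] (W : WeierstrassCurve ℚ) (K : Type) [Field K] [NumberField K], kolyvagin N W K)
    (hidx : ∀ (N : ℕ) [NeZero N] (K : Type) [Field K] [NumberField K] (Dt : ModularParametrizationData W N)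
      (H : HeegnerDatum N (NumberField.discr K)) (ι : K →+* ℂ) (P : (W.baseChange K).toAffine.Point),
      W.conductorNorm ℤ = N → NumberField.discr K = d →
      WeierstrassCurve.Affine.Point.map ι.toRatAlgHom P = heegnerPointComplex Dt H → ¬ (p : ℤ) ∣ Dt.c →
      padicValNat p (AddSubgroup.zmultiples P).index ≤ padicValNat p W.tamagawaProduct) :
    ∀ (N : ℕ) [NeZero N] (K : Type) [Field K] [NumberField K] (Dt : ModularParametrizationData W N)
      (H : HeegnerDatum N (NumberField.discr K)) (ι : K →+* ℂ) (P : (W.baseChange K).toAffine.Point),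
      ClassX11b W p → 5 ≤ p → Surj W p → W.conductorNorm ℤ = N → IsImaginaryQuadratic K →
      Odd (NumberField.discr K) → ¬ (p : ℤ) ∣ NumberField.discr K → ¬ p ∣ Units.torsionOrder K →
      SatisfiesHeegnerHypothesis N K → (W.quadraticTwist (NumberField.discr K : ℚ)).entireLFunction 1 ≠ 0 →
      WeierstrassCurve.Affine.Point.map ι.toRatAlgHom P = heegnerPointComplex Dt H →
      ¬ (p : ℤ) ∣ Dt.c → ¬ IsOfFinAddOrder P → NumberField.discr K = d →
      ∀ (κ : ZpExtension K p), κ.IsAnticyclotomic →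
        ∀ (γ : Field.absoluteGaloisGroup K) [Fact (κ.IsTopGenerator γ)]
          (𝔭 : HeightOneSpectrum (𝓞 K)) (h𝔭 : ((p : ℕ) : 𝓞 K) ∈ 𝔭.asIdeal)
          (he : 𝔭.asIdeal.ramificationIdx (𝓞 ℚ) = 1) (hf : 𝔭.asIdeal.inertiaDeg (𝓞 ℚ) = 1),
          IMCLowerWaldspurgerOnTreeAt p κ 𝔭 γ (embAt K p 𝔭 h𝔭 he hf) P := by
  intro N _ K _ _ Dt H ι P hX hp5 hsurj hN hK hodd hdK htor hHN hL hP hc hPinf hd κ hκ γ _ 𝔭 h𝔭 he hf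
  have hCTL : ControlOnTreeAt p κ 𝔭 γ (embAt K p 𝔭 h𝔭 he hf) P :=
    p2ControlOnTreeAt_of_thm331Mult W p h331 hKo N K Dt H ι P hX hp5 hsurj hN hK hodd hdK htor hHN hL hP hc hPinf κ hκ γ 𝔭 h𝔭 he hf
  obtain ⟨-, hfinK⟩ := hKo N W K hK hHN ⟨Dt, H, ι, hP⟩ hPinf
  haveI : Finite (W.baseChange K).sha := hfinK
  exact imcLowerWaldspurgerOnTreeAt_of_controlOnTreeAt_of_index_le_tamagawa hp5 hK hN hHN hCTL (hidx N K Dt H ι P hN hd hP hc)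

/-- **The same over the route's support items BY NAME** (`PublishedInputsFive` 19066 — only its Kolyvagin conjunct is used — and
`JSWAnticyclotomicControlMult` 19626). CONDITIONAL; nothing booked. [cite: JetchevSkinnerWan2017, Thm. 3.3.1] [cite: Kolyvagin1990, Thm. A] -/
theorem openInputAtField_of_items_of_indexCert (W : WeierstrassCurve ℚ) [W.IsElliptic] [W.IsGloballyMinimal]
    (p : ℕ) [Fact p.Prime] (d : ℤ) (hF : PublishedInputsFive) (h331 : JSWAnticyclotomicControlMult)
    (hidx : ∀ (N : ℕ) [NeZero N] (K : Type) [Field K] [NumberField K] (Dt : ModularParametrizationData W N)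
      (H : HeegnerDatum N (NumberField.discr K)) (ι : K →+* ℂ) (P : (W.baseChange K).toAffine.Point),
      W.conductorNorm ℤ = N → NumberField.discr K = d →
      WeierstrassCurve.Affine.Point.map ι.toRatAlgHom P = heegnerPointComplex Dt H → ¬ (p : ℤ) ∣ Dt.c →
      padicValNat p (AddSubgroup.zmultiples P).index ≤ padicValNat p W.tamagawaProduct) :
    ∀ (N : ℕ) [NeZero N] (K : Type) [Field K] [NumberField K] (Dt : ModularParametrizationData W N)
      (H : HeegnerDatum N (NumberField.discr K)) (ι : K →+* ℂ) (P : (W.baseChange K).toAffine.Point),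
      ClassX11b W p → 5 ≤ p → Surj W p → W.conductorNorm ℤ = N → IsImaginaryQuadratic K →
      Odd (NumberField.discr K) → ¬ (p : ℤ) ∣ NumberField.discr K → ¬ p ∣ Units.torsionOrder K →
      SatisfiesHeegnerHypothesis N K → (W.quadraticTwist (NumberField.discr K : ℚ)).entireLFunction 1 ≠ 0 →
      WeierstrassCurve.Affine.Point.map ι.toRatAlgHom P = heegnerPointComplex Dt H →
      ¬ (p : ℤ) ∣ Dt.c → ¬ IsOfFinAddOrder P → NumberField.discr K = d →
      ∀ (κ : ZpExtension K p), κ.IsAnticyclotomic →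
        ∀ (γ : Field.absoluteGaloisGroup K) [Fact (κ.IsTopGenerator γ)]
          (𝔭 : HeightOneSpectrum (𝓞 K)) (h𝔭 : ((p : ℕ) : 𝓞 K) ∈ 𝔭.asIdeal)
          (he : 𝔭.asIdeal.ramificationIdx (𝓞 ℚ) = 1) (hf : 𝔭.asIdeal.inertiaDeg (𝓞 ℚ) = 1),
          IMCLowerWaldspurgerOnTreeAt p κ 𝔭 γ (embAt K p 𝔭 h𝔭 he hf) P := by
  obtain ⟨-, hKo, -⟩ := hF
  exact openInputAtField_of_thm331Mult_of_indexCert W p d h331 hKo hidx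

end Summit.BirchSwinnertonDyer.BirchSwinnertonDyer.Theorems

end
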